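import Literature.AnabelianGeometry.AbsoluteAnabelian.AbsTopICuspInertiaOfPSCLem45iv
import Literature.AnabelianGeometry.SemiGraphs.PSCCoveringDatumSturdy
import HarnessLib

/-!
# [AbsTopI] Lemma 4.5 (iv) ⇐ (iii) for every open subgroup: the cusp-count dictionary `r = d + 1`
# (sub-DAG row B2) — proof-only companion

S. Mochizuki, *Topics in Absolute Anabelian Geometry I: Generalities* (2012) [AbsTopI], Lemma 4.5,
manuscript pp. 53–55 (lit key `paper:url-11ac98ba15fc`).  (iii), third sentence (p. 54): "if
`χ = χ^{cyclo}_G`, then the divisor of cusps of the covering of `X ×_k k̃` determined by `H` is a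
disjoint union of `d_χ(H^{ab} ⊗ ℚ_l) + 1` copies of `Spec(k̃)`"; (iv) (p. 54, as amended in [IUTchI]
Rmk 1.2.2 (ii) p. 40): "[in light of assertion (iii)] the decomposition groups of cusps `⊆ H_*` may be
characterized ["group-theoretically"] as the maximal closed subgroups `I ⊆ H_*` isomorphic to `ℤ_l` which
satisfy [`d((I^l·J)^{ab} ⊗ ℚ_l) + 1 < l · {d((I·J)^{ab} ⊗ ℚ_l) + 1}` …]" — i.e. (iv) consumes (iii)
through the DICTIONARY "`r(V) = d(V) + 1` for every open `V ⊆ H_*`" between the number of cusps `r(V)`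
of the covering determined by `V` and the representation-theoretic count `d(V) = d_{χ^{cyclo}}(V^{ab} ⊗ ℚ_l)`.

abc-iut cell, sub-DAG `plan/L4/SUBDAG-AbsTopI-Lem45.md`, row **B2** `FundamentalExtension.CuspCountDictionary`
(typed by abc-iut-w5-d062, p413974; the LAST open kernel-reachable row of the sub-DAG — every other
row is CLOSED, rows B5 / B5@ofPSC being proved MODULO B2), abc-iut-L4-lead RULING #6c «LEM45-B2»
(seat abc-iut-L4-t4, the typer of `CuspCountData` / `CuspNumberData`, `AbsTopIChains.lean`).
Typing policy θ of the parents: `CuspCountData.d` and `CuspNumberData.r` are abstract INPUT data,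
so the dictionary cannot hold for arbitrary data; this file proves it FROM (iii) APPLIED TO EVERY
OPEN `V` (sub-node A11 `Lem45iii_cuspCount`, PROVED from the weight count A9 and the duality A10 by
abc-iut-w5-d062, `cuspCountOfWeights_holds`), for any cusp-count data `d` that IS the printed
`d_{χ^{cyclo}}(V^{ab} ⊗ ℚ_l)` of a family of `G`-representations `ρ_V` (the identification is the
explicit hypothesis `hd`; abc-iut-L4-t15's `dChi`), and for the CANONICAL such data (no `hd`):

* `cuspCountDictionary_of_lem45iii_cuspCount` — (iii) for every open `V` ⇒ `r = d + 1`;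
* `cuspCountDictionary_of_weights` — the same from A11's own inputs (A9 `CuspCountViaWeights`,
  A10 `DualRankEq`) for every open `V`;
* `cuspCountDictionary_canonical` — for `d := (V ↦ d_{χ^{cyclo}}(ρ_V))` itself (as a natural number;
  `r(V) ≥ 1` makes `d_χ ≥ 0`), (iii) for every open `V` IS the dictionary;
* **`CuspInertiaData.lem45ivCharacterisation_ofPSC_of_lem45iii`** — plugging B2 into abc-iut-L4-t15's
  `lem45ivCharacterisation_ofPSC`: [AbsTopI] Lemma 4.5 (iv) [amended] at `ofPSC G` for every pro-`{l}`
  PSC datum with a cusp, MODULO exactly (iii) at every open `V` (for the representations `V^{ab} ⊗ ℚ_l`)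
  and layer L3's named characterisation of cuspidal edge-like subgroups — B2 is no longer an input;
  `…_canonical` variant with the canonical `d`.

No definition, no named fact.  HONEST FRAMING: bookkeeping between two typings of a refereed lemma;
(iii) itself (weights of Frobenius, [CombGC] §2) stays the INPUT (rows A3/A7/A9, campaign L); nothing
here bears on [IUTchIII] Cor. 3.12.
-/

noncomputable section

open scoped Classical Pointwise

namespace Literature.AnabelianGeometry.AbsoluteAnabelian.FundamentalExtension

open Literature.AnabelianGeometry.AbsoluteAnabelian.AbsTopI Literature.AnabelianGeometry.SemiGraphs

universe u v w

variable {Hstar : Type u} [Group Hstar] [TopologicalSpace Hstar]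
variable {G : Type u} [Group G] [TopologicalSpace G]
variable {K : Type v} [Field K]
variable {W : Subgroup Hstar → Type w} [∀ V, AddCommGroup (W V)] [∀ V, Module K (W V)]

/-! ### B2 from (iii) applied to every open subgroup -/

/-- **Row B2 from (iii) for every open `V`**: if the cusp-count data `d` is the printed
`d(V) = d_{χ^{cyclo}_G}(V^{ab} ⊗ ℚ_l)` of a family of `G`-representations `ρ_V` (`hd`, abc-iut-L4-t15's
`dChi`) and [AbsTopI] Lemma 4.5 (iii), third sentence, holds for the covering determined by every open
`V ⊆ H_*` ("the divisor of cusps … is a disjoint union of `d_χ(V^{ab} ⊗ ℚ_l) + 1` copies of `Spec(k̃)`",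
`Lem45iii_cuspCount χcyclo ρ_V (r V)`), then `r(V) = d(V) + 1` for every open `V` (`CuspCountDictionary`).
[cite: MochizukiAbsTopI2012, Lemma 4.5 (iii)(iv) p.54] -/
theorem cuspCountDictionary_of_lem45iii_cuspCount (χcyclo : G →* Kˣ)
    (ρ : ∀ V : Subgroup Hstar, G →* (W V ≃ₗ[K] W V)) (d : CuspCountData Hstar)
    (r : CuspNumberData Hstar)
    (hd : ∀ V : Subgroup Hstar, IsOpen (V : Set Hstar) → (d.d V : ℤ) = dChi (ρ V) χcyclo)
    (h3 : ∀ V : Subgroup Hstar, IsOpen (V : Set Hstar) → Lem45iii_cuspCount χcyclo (ρ V) (r.r V)) :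
    CuspCountDictionary d r := by
  intro V hV
  have h := h3 V hV
  unfold Lem45iii_cuspCount at h
  rw [← hd V hV] at h
  exact_mod_cast h

/-- **Row B2 from the inputs of A11** (the weight count A9 `CuspCountViaWeights` and the duality A10
`DualRankEq`, for every open `V`), through abc-iut-w5-d062's PROVED assembly `cuspCountOfWeights_holds`.
[cite: MochizukiAbsTopI2012, Lemma 4.5 (iii)(iv) p.54] -/
theorem cuspCountDictionary_of_weights [∀ V, FiniteDimensional K (W V)] (χcyclo : G →* Kˣ)
    (ρ : ∀ V : Subgroup Hstar, G →* (W V ≃ₗ[K] W V)) (d : CuspCountData Hstar)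
    (r : CuspNumberData Hstar)
    (hd : ∀ V : Subgroup Hstar, IsOpen (V : Set Hstar) → (d.d V : ℤ) = dChi (ρ V) χcyclo)
    (hA9 : ∀ V : Subgroup Hstar, IsOpen (V : Set Hstar) → CuspCountViaWeights χcyclo (ρ V) (r.r V))
    (hA10 : ∀ V : Subgroup Hstar, IsOpen (V : Set Hstar) → DualRankEq (ρ V)) :
    CuspCountDictionary d r :=
  cuspCountDictionary_of_lem45iii_cuspCount χcyclo ρ d r hd fun V hV =>
    cuspCountOfWeights_holds χcyclo (ρ V) (r.r V) (hA9 V hV) (hA10 V hV)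

omit [TopologicalSpace Hstar] in
/-- With at least one cusp on every covering (`r(V) ≥ 1`), (iii) forces `d_{χ^{cyclo}}(V^{ab} ⊗ ℚ_l) ≥ 0`.
[cite: MochizukiAbsTopI2012, Lemma 4.5 (iii) p.54] -/
theorem dChi_nonneg_of_lem45iii_cuspCount (χcyclo : G →* Kˣ) {V : Subgroup Hstar}
    (ρV : G →* (W V ≃ₗ[K] W V)) {n : ℕ} (h3 : Lem45iii_cuspCount χcyclo ρV n) (hn : 0 < n) :
    0 ≤ dChi ρV χcyclo := by
  unfold Lem45iii_cuspCount at h3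
  have : (1 : ℤ) ≤ n := by exact_mod_cast hn
  linarith

/-- **Row B2 for the CANONICAL cusp-count data** `d(V) := d_{χ^{cyclo}}(ρ_V)` (read in `ℕ`): when every
covering has a cusp (`r(V) ≥ 1`, "`X` is not proper", (iv)), (iii) for every open `V` IS the dictionary —
no identification hypothesis. [cite: MochizukiAbsTopI2012, Lemma 4.5 (iii)(iv) p.54] -/
theorem cuspCountDictionary_canonical (χcyclo : G →* Kˣ)
    (ρ : ∀ V : Subgroup Hstar, G →* (W V ≃ₗ[K] W V)) (r : CuspNumberData Hstar)
    (hr : ∀ V : Subgroup Hstar, IsOpen (V : Set Hstar) → 0 < r.r V)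
    (h3 : ∀ V : Subgroup Hstar, IsOpen (V : Set Hstar) → Lem45iii_cuspCount χcyclo (ρ V) (r.r V)) :
    CuspCountDictionary ⟨fun V => (dChi (ρ V) χcyclo).toNat⟩ r := by
  refine cuspCountDictionary_of_lem45iii_cuspCount χcyclo ρ _ r (fun V hV => ?_) h3
  exact Int.toNat_of_nonneg (dChi_nonneg_of_lem45iii_cuspCount χcyclo (ρ V) (h3 V hV) (hr V hV))

/-! ### [AbsTopI] Lemma 4.5 (iv) [amended] at `ofPSC`, modulo (iii) only -/

variable [IsTopologicalGroup Hstar] [CompactSpace Hstar] [T2Space Hstar] [TotallyDisconnectedSpace Hstar]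
  (P : PSCDatum Hstar)

omit [T2Space Hstar] [TotallyDisconnectedSpace Hstar] in
/-- A PSC datum WITH a cusp has a cusp on every finite covering: `r(G_V) ≥ 1` for every open `V`
(layer L3's `cuspCount_eq_zero_iff`: every cusp has a cusp above it).
[cite: MochizukiCombGC2007, Def 1.1 (ii) p.6] -/
theorem cuspCount_pos_of_isOpen (hC : Nonempty P.graph.C) (V : Subgroup Hstar)
    (hV : IsOpen (V : Set Hstar)) : 0 < P.cuspCount V := by
  haveI : Finite (Hstar ⧸ V) := Subgroup.quotient_finite_of_isOpen V hV
  haveI : V.FiniteIndex := Subgroup.finiteIndex_iff_finite_quotient.mpr inferInstance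
  rw [Nat.pos_iff_ne_zero, Ne, P.cuspCount_eq_zero_iff V, PSCSemiGraph.r, Fintype.card_eq_zero_iff]
  exact not_isEmpty_of_nonempty _

/-- **[AbsTopI] Lemma 4.5 (iv) [amended] at `ofPSC P`, modulo (iii) at every open `V`**: for a
pro-`{l}` PSC datum `P` on a profinite `H_*` with a cusp, layer L3's named characterisation of cuspidal
edge-like subgroups ([IUTchI] Rmk 1.2.3 (iv)), a family of `G`-representations `ρ_V` (the printed
`V^{ab} ⊗ ℚ_l`) with cusp-count data `d = d_{χ^{cyclo}}(ρ_V)` (`hd`) satisfying (iii), third sentence,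
for the cusp numbers `r(V) = r(P_V)` of the coverings: the cusp inertia subgroups of `H_*` are EXACTLY
the maximal cuspidal candidates of abc-iut-L4-t4's amended criterion.  Row B2 is discharged by
`cuspCountDictionary_of_lem45iii_cuspCount`; rows B3/B4/B5 by abc-iut-L4-t15 / abc-iut-L4-t6 / abc-iut-w5-d062.
[cite: MochizukiAbsTopI2012, Lemma 4.5 (iv) p.54] [cite: Mochizuki2012, IUTchI Rmk 1.2.2 (ii) p.40] -/
theorem CuspInertiaData.lem45ivCharacterisation_ofPSC_of_lem45iii {l : ℕ} (hS : P.Sigma = {l})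
    (hC : Nonempty P.graph.C) (h : P.CuspidalEdgeLikeCharacterization) (χcyclo : G →* Kˣ)
    (ρ : ∀ V : Subgroup Hstar, G →* (W V ≃ₗ[K] W V)) (d : CuspCountData Hstar)
    (hd : ∀ V : Subgroup Hstar, IsOpen (V : Set Hstar) → (d.d V : ℤ) = dChi (ρ V) χcyclo)
    (h3 : ∀ V : Subgroup Hstar, IsOpen (V : Set Hstar) →
      Lem45iii_cuspCount χcyclo (ρ V) (P.cuspCount V)) :
    (CuspInertiaData.ofPSC P).Lem45ivCharacterisation l d :=
  CuspInertiaData.lem45ivCharacterisation_ofPSC P hS hC h d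
    (cuspCountDictionary_of_lem45iii_cuspCount χcyclo ρ d (CuspInertiaData.ofPSC P).r hd h3)

/-- The same for the CANONICAL cusp-count data `d := (V ↦ d_{χ^{cyclo}}(ρ_V))` — [AbsTopI] Lemma 4.5
(iv) [amended] at `ofPSC P` with NO dictionary hypothesis: the cusp inertia subgroups of `H_*` are exactly
the maximal closed `I ≅ ℤ_l` with `d_{χ^{cyclo}}(ρ_{I^l·J}) + 1 < l · (d_{χ^{cyclo}}(ρ_{I·J}) + 1)` for all
characteristic open `J ≠ I·J`, GIVEN (iii) for every open `V` and L3's characterisation.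
[cite: MochizukiAbsTopI2012, Lemma 4.5 (iv) p.54] [cite: Mochizuki2012, IUTchI Rmk 1.2.2 (ii) p.40] -/
theorem CuspInertiaData.lem45ivCharacterisation_ofPSC_canonical {l : ℕ} (hS : P.Sigma = {l})
    (hC : Nonempty P.graph.C) (h : P.CuspidalEdgeLikeCharacterization) (χcyclo : G →* Kˣ)
    (ρ : ∀ V : Subgroup Hstar, G →* (W V ≃ₗ[K] W V))
    (h3 : ∀ V : Subgroup Hstar, IsOpen (V : Set Hstar) →
      Lem45iii_cuspCount χcyclo (ρ V) (P.cuspCount V)) :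
    (CuspInertiaData.ofPSC P).Lem45ivCharacterisation l ⟨fun V => (dChi (ρ V) χcyclo).toNat⟩ :=
  CuspInertiaData.lem45ivCharacterisation_ofPSC P hS hC h _
    (cuspCountDictionary_canonical χcyclo ρ (CuspInertiaData.ofPSC P).r
      (fun V hV => cuspCount_pos_of_isOpen P hC V hV) h3)

/-- Pointwise form: under the same hypotheses, a subgroup `I ⊆ H_*` is a cusp inertia subgroup iff it is
a maximal cuspidal candidate for the canonical data, iff it is one of layer L3's CUSPIDAL subgroups.
[cite: MochizukiAbsTopI2012, Lemma 4.5 (iv) p.54] -/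
theorem CuspInertiaData.isCuspidal_iff_isMaximalCuspidalCandidate_canonical {l : ℕ} (hS : P.Sigma = {l})
    (hC : Nonempty P.graph.C) (h : P.CuspidalEdgeLikeCharacterization) (χcyclo : G →* Kˣ)
    (ρ : ∀ V : Subgroup Hstar, G →* (W V ≃ₗ[K] W V))
    (h3 : ∀ V : Subgroup Hstar, IsOpen (V : Set Hstar) →
      Lem45iii_cuspCount χcyclo (ρ V) (P.cuspCount V)) (I : Subgroup Hstar) :
    P.IsCuspidal I ↔ IsMaximalCuspidalCandidate l ⟨fun V => (dChi (ρ V) χcyclo).toNat⟩ I :=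
  CuspInertiaData.isCuspidal_iff_isMaximalCuspidalCandidate P hS hC h _
    (fun V hV => cuspCountDictionary_canonical χcyclo ρ (CuspInertiaData.ofPSC P).r
      (fun V hV => cuspCount_pos_of_isOpen P hC V hV) h3 V hV) I

end Literature.AnabelianGeometry.AbsoluteAnabelian.FundamentalExtension

end
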